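import Summits.QuantumFields.YangMills.Theorems.AlphaInputsT3ACv3AbelianTensorSums
import HarnessLib

/-!
# `AlphaInputsT3ACv3AbelianTensorBounds` — STRATEGY B for 2′, (LL) the linear regional lift: WHERE THE CUBE TERMS LIVE, AND HOW LARGE THE SMOOTH PARTS ARE — lane
# `pub-balaban3d`, seat alpha-2 (g5)

WHY.  The curl of the lift `naive(A) + Σ_P (curl A)(P)·e_P + Σ_C φ_C·r_C` under the region is `Σ_P (curl A)(P)·σ_P − Σ_{C partial} φ_C·(K_C^{θ(C)} + Y_C^{θ(C)})`
(siblings `…v3AbelianTensor`, `…v3AbelianRegionalLift`).  THIS FILE supplies the three facts that turn this into the bound `|curl| ≤ C·ε·L^{−2k}`: §1 block labels of a finest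
site from its cyclic offset (home block, next block, the shifted site at the crossing bond); §2 ★ INVISIBILITY: if the cube term `K_C^θ` is nonzero at a finest plaquette then one
of the plaquette's four corners lies in the corner block `y + θ` of the cube — so hosting at a block OUTSIDE the region makes `K_C^θ` vanish at every plaquette under the region;
§3 reading the cube below: `K_C` with offsets shifted by `L^k·e_λ` is the cube term of the cube at `y − e_λ`; §4 ★ the BOUNDS `Σ_y |σ_P(y)| ≤ 192·L^{−2k}` and
`Σ_y |Y_C^{θ(y)}(y)| ≤ 768·L^{−2k}` at every finest plaquette, for ANY assignment `θ` of hosting corners (sums over the level-`k` sites factor over the three coordinates;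
per coordinate the 1D sums of `…v3AbelianShapes1DSums` §7).
HONEST FRAMING.  Kernel algebra and explicit arithmetic; nothing of [B10]∕[7]∕[4] asserted; count-neutral helper toward R3 2′ (`stub_laneRecordsV3`, items 19935∕19936);
registry untouched; nothing about d = 4, the continuum, or a mass gap.

References: T. Bałaban, Commun. Math. Phys. 102 (1985) 277–309 [Balaban1985Variational] ((8) p.279); CMP 109 (1987) 249–301 [Balaban1987RG1] ((0.3)–(0.4) pp.252–253).
-/

set_option autoImplicit false

noncomputable section

namespace Summit.QuantumFields.YangMills.Theorems.AbelianEML.Tensor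

open scoped BigOperators
open Literature.MathematicalPhysics.QuantumFieldTheory.Balaban1983to89
open Literature.MathematicalPhysics.QuantumFieldTheory.Balaban1983to89.T3ContinuumYM3Torus
open Literature.MathematicalPhysics.QuantumFieldTheory.Balaban1983to89.BlockAveragingEMLProp2 (shift_shift_comm)
open Summit.QuantumFields.YangMills.Theorems.AbelianEML.Shapes1D
open Summit.QuantumFields.Balaban3D.Carriers (coarsen)

variable {F : T3Family} {K k : ℕ}

/-! ## §1 Block labels from cyclic offsets -/

/-- The offset modulo the period, in the two cases of its definition. [folklore] -/
theorem rho_mod_cases (hk : k ≤ K) (y : Site (F.P K) k) (z : Site (F.P K) 0) (i : Fin 3) :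
    (F.L ^ k * (y i).val ≤ (z i).val → rho y z i % N0 F K = (z i).val - F.L ^ k * (y i).val) ∧
    ((z i).val < F.L ^ k * (y i).val → rho y z i % N0 F K = (z i).val + (N0 F K - F.L ^ k * (y i).val)) := by
  obtain ⟨h1, h2, h3⟩ := sizes (F := F) hk
  have hv : (z i).val < N0 F K := ZMod.val_lt _
  have hY : F.L ^ k * (y i).val + F.L ^ k ≤ N0 F K := by
    have : (y i).val + 1 ≤ nc F K k := ZMod.val_lt (y i)
    calc F.L ^ k * (y i).val + F.L ^ k = F.L ^ k * ((y i).val + 1) := by ring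
      _ ≤ F.L ^ k * nc F K k := Nat.mul_le_mul_left _ this
      _ = N0 F K := h1.symm
  constructor
  · intro hle
    rw [rho, show (z i).val + (N0 F K - F.L ^ k * (y i).val) = ((z i).val - F.L ^ k * (y i).val) + N0 F K by omega, Nat.add_mod_right,
      Nat.mod_eq_of_lt (by omega)]
  · intro hlt
    rw [rho, Nat.mod_eq_of_lt (by omega)]

/-- **HOME BLOCK**: `ρ_i mod N₀ < L^k` means the site lies in the block `y_i` along axis `i`. [cite: Balaban1987RG1, (0.3) p.252] -/
theorem div_eq_of_rho_lt (hk : k ≤ K) (y : Site (F.P K) k) (z : Site (F.P K) 0) (i : Fin 3) (h : rho y z i % N0 F K < F.L ^ k) :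
    (z i).val / F.L ^ k = (y i).val := by
  obtain ⟨h1, h2, h3⟩ := sizes (F := F) hk
  obtain ⟨cA, cB⟩ := rho_mod_cases hk y z i
  have hY : F.L ^ k * (y i).val + F.L ^ k ≤ N0 F K := by
    have : (y i).val + 1 ≤ nc F K k := ZMod.val_lt (y i)
    calc F.L ^ k * (y i).val + F.L ^ k = F.L ^ k * ((y i).val + 1) := by ring
      _ ≤ F.L ^ k * nc F K k := Nat.mul_le_mul_left _ this
      _ = N0 F K := h1.symm
  rcases Nat.lt_or_ge (z i).val (F.L ^ k * (y i).val) with hlt | hle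
  · rw [cB hlt] at h; omega
  · rw [cA hle] at h
    apply Nat.div_eq_of_lt_le
    · rw [mul_comm]; exact hle
    · have : ((y i).val + 1) * F.L ^ k = F.L ^ k * (y i).val + F.L ^ k := by ring
      omega

/-- **NEXT BLOCK**: `L^k ≤ ρ_i mod N₀ < 2L^k` means the site lies in the block `y_i + 1` along axis `i` (torus wrap-around included). [cite: Balaban1987RG1, (0.3) p.252] -/
theorem div_eq_of_rho_next (hk : k ≤ K) (y : Site (F.P K) k) (z : Site (F.P K) 0) (i : Fin 3) (ha : F.L ^ k ≤ rho y z i % N0 F K)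
    (hb : rho y z i % N0 F K < 2 * F.L ^ k) : (z i).val / F.L ^ k = ((y i).val + 1) % nc F K k := by
  obtain ⟨h1, h2, h3⟩ := sizes (F := F) hk
  obtain ⟨cA, cB⟩ := rho_mod_cases hk y z i
  have hv : (z i).val < N0 F K := ZMod.val_lt _
  have hYlt : (y i).val + 1 ≤ nc F K k := ZMod.val_lt (y i)
  rcases Nat.lt_or_ge (z i).val (F.L ^ k * (y i).val) with hlt | hle
  · rw [cB hlt] at ha hb
    -- wrap-around: only possible when `y_i` is the last block and `z_i` the first
    rcases Nat.lt_or_ge ((y i).val + 1) (nc F K k) with hY | hY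
    · exfalso
      have : F.L ^ k * ((y i).val + 2) ≤ F.L ^ k * nc F K k := Nat.mul_le_mul_left _ (by omega)
      have e : F.L ^ k * ((y i).val + 2) = F.L ^ k * (y i).val + 2 * F.L ^ k := by ring
      rw [← h1, e] at this
      omega
    · have hYe : (y i).val + 1 = nc F K k := le_antisymm hYlt hY
      rw [hYe, Nat.mod_self]
      apply Nat.div_eq_of_lt
      have e : N0 F K = F.L ^ k * (y i).val + F.L ^ k := by rw [h1, ← hYe]; ring
      omega
  · rw [cA hle] at ha hb
    have hY2 : F.L ^ k * (y i).val + 2 * F.L ^ k ≤ N0 F K ∨ (y i).val + 1 = nc F K k := by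
      rcases Nat.lt_or_ge ((y i).val + 1) (nc F K k) with hY | hY
      · left
        have : F.L ^ k * ((y i).val + 2) ≤ F.L ^ k * nc F K k := Nat.mul_le_mul_left _ (by omega)
        have e : F.L ^ k * ((y i).val + 2) = F.L ^ k * (y i).val + 2 * F.L ^ k := by ring
        rw [← h1, e] at this; exact this
      · right; exact le_antisymm hYlt hY
    rcases hY2 with hY2 | hYe
    · have hq : (z i).val / F.L ^ k = (y i).val + 1 := by
        apply Nat.div_eq_of_lt_le
        · have e : ((y i).val + 1) * F.L ^ k = F.L ^ k * (y i).val + F.L ^ k := by ring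
          omega
        · have e : ((y i).val + 1 + 1) * F.L ^ k = F.L ^ k * (y i).val + 2 * F.L ^ k := by ring
          omega
      rw [hq, Nat.mod_eq_of_lt]
      by_contra hc
      have hYe : (y i).val + 1 = nc F K k := by omega
      have e : N0 F K = F.L ^ k * (y i).val + F.L ^ k := by rw [h1, ← hYe]; ring
      omega
    · exfalso
      have e : N0 F K = F.L ^ k * (y i).val + F.L ^ k := by rw [h1, ← hYe]; ring
      omega

/-- **THE CROSSING BOND**: if `ρ_i mod N₀ = L^k − 1` then the shifted site lies in the block `y_i + 1` along axis `i`. [cite: Balaban1987RG1, (0.3) p.252] -/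
theorem div_shift_eq_of_rho_eq (hk : k ≤ K) (y : Site (F.P K) k) (z : Site (F.P K) 0) (i : Fin 3) (h : rho y z i % N0 F K = F.L ^ k - 1) :
    ((z.shift i) i).val / F.L ^ k = ((y i).val + 1) % nc F K k := by
  obtain ⟨h1, h2, h3⟩ := sizes (F := F) hk
  have hdvd : F.L ^ k ∣ N0 F K := ⟨nc F K k, h1⟩
  have hhome := div_eq_of_rho_lt hk y z i (by omega)
  -- `z_i mod L^k = L^k − 1`: reduce the offset congruence mod `L^k`
  have hmod : (z i).val % F.L ^ k = F.L ^ k - 1 := by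
    have e : (rho y z i + F.L ^ k * (y i).val) % N0 F K = (z i).val := by
      have hY : F.L ^ k * (y i).val ≤ N0 F K := by
        rw [h1]; exact Nat.mul_le_mul_left _ (ZMod.val_lt (y i)).le
      rw [rho, show (z i).val + (N0 F K - F.L ^ k * (y i).val) + F.L ^ k * (y i).val = (z i).val + N0 F K by omega, Nat.add_mod_right,
        Nat.mod_eq_of_lt (ZMod.val_lt _)]
    have e2 : (z i).val % F.L ^ k = (rho y z i + F.L ^ k * (y i).val) % N0 F K % F.L ^ k := by rw [e]
    rw [e2, Nat.mod_mod_of_dvd _ hdvd, Nat.add_mul_mod_self_left, ← Nat.mod_mod_of_dvd _ hdvd, h, Nat.mod_eq_of_lt (by omega)]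
  have hc := coarsen_shift hk z i
  rw [if_pos hmod] at hc
  have := congrArg (fun w : Site (F.P K) k => (w i).val) hc
  rw [val_coarsen3 hk] at this
  rw [this, Site.shift_apply, if_pos rfl, ZMod.val_add, ZMod.val_one, val_coarsen3 hk, hhome]

/-! ## §2 Invisibility of hosted cube terms -/

section Corner

variable (F K k)

/-- **THE CORNER SITE** `y + θ` of the cube at `y` (`θ ∈ {0,1}³`). [cite: Balaban1985Variational, (8) p.279] -/
def corner (θ : Fin 3 → Bool) (y : Site (F.P K) k) : Site (F.P K) k := fun i => bif θ i then y i + 1 else y i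

variable {F K k}

/-- Labels of the corner site. [folklore] -/
theorem val_corner (θ : Fin 3 → Bool) (y : Site (F.P K) k) (i : Fin 3) :
    (corner F K k θ y i).val = bif θ i then ((y i).val + 1) % nc F K k else (y i).val := by
  simp only [corner]
  cases θ i
  · rfl
  · show (y i + 1).val = _
    rw [ZMod.val_add, ZMod.val_one]; rfl

/-- The slot alternatives: a nonzero hosted factor at slot `i` places `z` (or, for the bond-type factors, possibly `z + e_i`) in the corner block along axis `i`. [folklore] -/
theorem slot_h (hk : k ≤ K) (θ : Bool) (y : Site (F.P K) k) (z : Site (F.P K) 0) (i : Fin 3) (h : h_ F K k θ (rho y z i) ≠ 0) :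
    (z i).val / F.L ^ k = (bif θ then ((y i).val + 1) % nc F K k else (y i).val) ∨
      ((z.shift i) i).val / F.L ^ k = (bif θ then ((y i).val + 1) % nc F K k else (y i).val) := by
  obtain ⟨h1, h2, h3⟩ := sizes (F := F) hk
  cases θ
  · left; exact div_eq_of_rho_lt hk y z i (hS_false_ne_zero h)
  · obtain ⟨ha, hb⟩ := hS_true_ne_zero h
    rcases Nat.lt_or_ge (rho y z i % N0 F K) (F.L ^ k) with hlt | hge
    · right
      have he : rho y z i % N0 F K = F.L ^ k - 1 := by omega
      exact div_shift_eq_of_rho_eq hk y z i he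
    · left
      have hb' : rho y z i % N0 F K < 2 * F.L ^ k := by omega
      exact div_eq_of_rho_next hk y z i hge hb'

/-- Slot alternative for a hosted cumulative: `z` itself is in the corner block. [folklore] -/
theorem slot_g (hk : k ≤ K) (θ : Bool) (y : Site (F.P K) k) (z : Site (F.P K) 0) (i : Fin 3) (h : g_ F K k θ (rho y z i) ≠ 0) :
    (z i).val / F.L ^ k = (bif θ then ((y i).val + 1) % nc F K k else (y i).val) := by
  cases θ
  · exact div_eq_of_rho_lt hk y z i (gS_false_ne_zero h)
  · obtain ⟨ha, hb⟩ := gS_true_ne_zero h; exact div_eq_of_rho_next hk y z i ha hb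

/-- Slot alternative for the crossing bond: `z` is in the home block and `z + e_i` in the next one. [folklore] -/
theorem slot_c (hk : k ≤ K) (θ : Bool) (y : Site (F.P K) k) (z : Site (F.P K) 0) (i : Fin 3) (h : c_ F K k (rho y z i) ≠ 0) :
    (z i).val / F.L ^ k = (bif θ then ((y i).val + 1) % nc F K k else (y i).val) ∨
      ((z.shift i) i).val / F.L ^ k = (bif θ then ((y i).val + 1) % nc F K k else (y i).val) := by
  have hc := cS_ne_zero h
  have h3 := (sizes (F := F) hk).2.2
  have hlt : rho y z i % N0 F K < F.L ^ k := by omega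
  cases θ
  · left; exact div_eq_of_rho_lt hk y z i hlt
  · right; exact div_shift_eq_of_rho_eq hk y z i hc

/-- From slot alternatives to a corner of the plaquette `(z; α, β)` lying in the corner block. [folklore] -/
theorem exists_corner (hk : k ≤ K) (θ : Fin 3 → Bool) (y : Site (F.P K) k) (z : Site (F.P K) 0) {α β γ : Fin 3} (hαβ : α ≠ β) (hαγ : α ≠ γ) (hβγ : β ≠ γ)
    (hα : (z α).val / F.L ^ k = (bif θ α then ((y α).val + 1) % nc F K k else (y α).val) ∨
      ((z.shift α) α).val / F.L ^ k = (bif θ α then ((y α).val + 1) % nc F K k else (y α).val))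
    (hβ : (z β).val / F.L ^ k = (bif θ β then ((y β).val + 1) % nc F K k else (y β).val) ∨
      ((z.shift β) β).val / F.L ^ k = (bif θ β then ((y β).val + 1) % nc F K k else (y β).val))
    (hγ : (z γ).val / F.L ^ k = (bif θ γ then ((y γ).val + 1) % nc F K k else (y γ).val)) :
    coarsen k z = corner F K k θ y ∨ coarsen k (z.shift α) = corner F K k θ y ∨ coarsen k (z.shift β) = corner F K k θ y ∨
      coarsen k ((z.shift α).shift β) = corner F K k θ y := by
  have hγ3 : ∀ i : Fin 3, i = α ∨ i = β ∨ i = γ := by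
    intro i; fin_cases i <;> fin_cases α <;> fin_cases β <;> fin_cases γ <;> simp_all
  have hβα : ¬ (@Eq (Fin (F.P K).d) β α) := fun h => hαβ h.symm
  have hαβ' : ¬ (@Eq (Fin (F.P K).d) α β) := fun h => hαβ h
  have hγα : ¬ (@Eq (Fin (F.P K).d) γ α) := fun h => hαγ h.symm
  have hγβ : ¬ (@Eq (Fin (F.P K).d) γ β) := fun h => hβγ h.symm
  simp only [coarsen_eq_iff hk, val_corner]
  -- evaluate a candidate corner coordinatewise
  have key : ∀ w : Site (F.P K) 0, (w α).val / F.L ^ k = (bif θ α then ((y α).val + 1) % nc F K k else (y α).val) →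
      (w β).val / F.L ^ k = (bif θ β then ((y β).val + 1) % nc F K k else (y β).val) →
      (w γ).val / F.L ^ k = (bif θ γ then ((y γ).val + 1) % nc F K k else (y γ).val) →
      ∀ i : Fin 3, (w i).val / F.L ^ k = (bif θ i then ((y i).val + 1) % nc F K k else (y i).val) := by
    intro w ha hb hc i
    rcases hγ3 i with rfl | rfl | rfl
    · exact ha
    · exact hb
    · exact hc
  rcases hα with hα | hα <;> rcases hβ with hβ | hβ
  · exact Or.inl (key z hα hβ hγ)
  · refine Or.inr (Or.inr (Or.inl (key _ ?_ hβ ?_)))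
    · rwa [Site.shift_apply, if_neg hαβ']
    · rwa [Site.shift_apply, if_neg hγβ]
  · refine Or.inr (Or.inl (key _ hα ?_ ?_))
    · rwa [Site.shift_apply, if_neg hβα]
    · rwa [Site.shift_apply, if_neg hγα]
  · refine Or.inr (Or.inr (Or.inr (key _ ?_ ?_ ?_)))
    · rw [Site.shift_apply, if_neg hαβ']; exact hα
    · rw [Site.shift_apply, if_pos rfl, Site.shift_apply, if_neg hβα]
      rwa [Site.shift_apply, if_pos rfl] at hβ
    · rwa [Site.shift_apply, if_neg hγβ, Site.shift_apply, if_neg hγα]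

/-- **★ INVISIBILITY OF HOSTED CUBE TERMS**: if no corner of the finest plaquette `(z; α, β)` lies in the corner block `y + θ`, every component of `K_C^θ` vanishes there.
(Component `0 ↔ (0,1)`, `1 ↔ (0,2)`, `2 ↔ (1,2)`.) [cite: Balaban1985Variational, (8) p.279] -/
theorem Kc_eq_zero_of_corners (hk : k ≤ K) (θ : Fin 3 → Bool) (y : Site (F.P K) k) (z : Site (F.P K) 0) :
    ((coarsen k z ≠ corner F K k θ y ∧ coarsen k (z.shift (0 : Fin 3)) ≠ corner F K k θ y ∧ coarsen k (z.shift (1 : Fin 3)) ≠ corner F K k θ y ∧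
        coarsen k ((z.shift (0 : Fin 3)).shift (1 : Fin 3)) ≠ corner F K k θ y) → Kc F K k θ 0 0 y z = 0) ∧
    ((coarsen k z ≠ corner F K k θ y ∧ coarsen k (z.shift (0 : Fin 3)) ≠ corner F K k θ y ∧ coarsen k (z.shift (2 : Fin 3)) ≠ corner F K k θ y ∧
        coarsen k ((z.shift (0 : Fin 3)).shift (2 : Fin 3)) ≠ corner F K k θ y) → Kc F K k θ 0 1 y z = 0) ∧
    ((coarsen k z ≠ corner F K k θ y ∧ coarsen k (z.shift (1 : Fin 3)) ≠ corner F K k θ y ∧ coarsen k (z.shift (2 : Fin 3)) ≠ corner F K k θ y ∧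
        coarsen k ((z.shift (1 : Fin 3)).shift (2 : Fin 3)) ≠ corner F K k θ y) → Kc F K k θ 0 2 y z = 0) := by
  refine ⟨fun ⟨h1, h2, h3, h4⟩ => ?_, fun ⟨h1, h2, h3, h4⟩ => ?_, fun ⟨h1, h2, h3, h4⟩ => ?_⟩ <;> by_contra hne <;>
    simp only [Kc, if_true, show ((1 : Fin 3) = 0) = False from by decide, show ((2 : Fin 3) = 0) = False from by decide,
      show ((2 : Fin 3) = 1) = False from by decide, if_false, Pi.zero_apply, add_zero, neg_eq_zero, mul_eq_zero, not_or] at hne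
  · obtain ⟨⟨ha, hb⟩, hc⟩ := hne
    rcases exists_corner hk θ y z (α := 0) (β := 1) (γ := 2) (by decide) (by decide) (by decide) (slot_h hk _ y z 0 ha) (slot_h hk _ y z 1 hb)
      (slot_g hk _ y z 2 hc) with h | h | h | h
    · exact h1 h
    · exact h2 h
    · exact h3 h
    · exact h4 h
  · obtain ⟨⟨ha, hb⟩, hc⟩ := hne
    rcases exists_corner hk θ y z (α := 0) (β := 2) (γ := 1) (by decide) (by decide) (by decide) (slot_h hk _ y z 0 ha) (slot_c hk (θ 2) y z 2 hc)
      (slot_g hk _ y z 1 hb) with h | h | h | h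
    · exact h1 h
    · exact h2 h
    · exact h3 h
    · exact h4 h
  · obtain ⟨⟨ha, hb⟩, hc⟩ := hne
    rcases exists_corner hk θ y z (α := 1) (β := 2) (γ := 0) (by decide) (by decide) (by decide) (slot_c hk (θ 1) y z 1 hb) (slot_c hk (θ 2) y z 2 hc)
      (slot_g hk _ y z 0 ha) with h | h | h | h
    · exact h1 h
    · exact h2 h
    · exact h3 h
    · exact h4 h

end Corner

/-! ## §3 Reading the cube below -/

/-- The offsets from the coarse site one step back in direction `λ` are the offsets from `y` shifted by `L^k·e_λ` (mod the period). [folklore] -/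
theorem rho_unshift_mod (hk : k ≤ K) (y : Site (F.P K) k) (z : Site (F.P K) 0) (lam i : Fin 3) :
    rho (y.unshift lam) z i % N0 F K = (rho y z i + below F k lam i) % N0 F K := by
  obtain ⟨h1, h2, h3⟩ := sizes (F := F) hk
  by_cases hi : i = lam
  · subst hi
    have hil : @Eq (Fin (F.P K).d) i i := rfl
    simp only [rho, below, Site.unshift_apply, if_true]
    set Y := (y i).val with hY
    set Y' := (y i - 1).val with hY'
    have hrel : (Y' + 1) % nc F K k = Y := by
      have e : y i - 1 + 1 = y i := sub_add_cancel _ _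
      have := congrArg ZMod.val e
      rw [ZMod.val_add, ZMod.val_one] at this
      exact this
    have hY'lt : Y' < nc F K k := ZMod.val_lt _
    have hYle : F.L ^ k * Y ≤ N0 F K := by rw [h1]; exact Nat.mul_le_mul_left _ (ZMod.val_lt (y i)).le
    rcases Nat.lt_or_ge (Y' + 1) (nc F K k) with hlt | hge
    · rw [Nat.mod_eq_of_lt hlt] at hrel
      have e : N0 F K - F.L ^ k * Y' = (N0 F K - F.L ^ k * Y) + F.L ^ k := by
        rw [← hrel, Nat.mul_add, mul_one]
        rw [← hrel, Nat.mul_add, mul_one] at hYle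
        omega
      rw [e, add_assoc]
    · have hYe : Y' + 1 = nc F K k := le_antisymm hY'lt hge
      rw [hYe, Nat.mod_self] at hrel
      have e1 : N0 F K - F.L ^ k * Y' = F.L ^ k := by
        have : N0 F K = F.L ^ k * Y' + F.L ^ k := by rw [h1, ← hYe]; ring
        omega
      rw [e1, ← hrel, mul_zero, Nat.sub_zero, show (z i).val + N0 F K + F.L ^ k = (z i).val + F.L ^ k + N0 F K by ring, Nat.add_mod_right]
  · have hi' : ¬ (@Eq (Fin (F.P K).d) i lam) := fun h => hi h
    simp only [rho, below, Site.unshift_apply, if_neg hi', if_neg hi, add_zero]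

/-- **★ THE CUBE BELOW**: the base cube term with offsets shifted by `L^k·e_λ` is the cube term of the cube at `y − e_λ`. [cite: Balaban1985Variational, (8) p.279] -/
theorem Kc_below (hk : k ≤ K) (αβ lam : Fin 3) (y : Site (F.P K) k) (z : Site (F.P K) 0) :
    Kc F K k θ0 (below F k lam) αβ y z = Kc F K k θ0 0 αβ (y.unshift lam) z := by
  have hh : ∀ i, h_ F K k false (rho y z i + below F k lam i) = h_ F K k false (rho (y.unshift lam) z i) :=
    fun i => hS_congr false (rho_unshift_mod hk y z lam i).symm
  have hg : ∀ i, g_ F K k false (rho y z i + below F k lam i) = g_ F K k false (rho (y.unshift lam) z i) :=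
    fun i => gS_congr false (rho_unshift_mod hk y z lam i).symm
  have hc : ∀ i, c_ F K k (rho y z i + below F k lam i) = c_ F K k (rho (y.unshift lam) z i) :=
    fun i => cS_congr (rho_unshift_mod hk y z lam i).symm
  simp only [Kc, θ0, hh, hg, hc, Pi.zero_apply, add_zero]

end Summit.QuantumFields.YangMills.Theorems.AbelianEML.Tensor

end
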